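import Literature.AnabelianGeometry.SemiGraphs.ProSigmaLevelSeparating
import HarnessLib

/-!
# [CombGC] Prop. 1.2, proof p. 9: edge-like separating coverings from LEVEL certificates (shape-independent assembly)

Mochizuki, *A combinatorial version of the Grothendieck conjecture*, Tohoku Math. J. **59** (2007)
[CombGC], PROOF of Proposition 1.2, author's manuscript p. 9, the resp'd (edge) case: "respectively,
`e₁ ≠ e₂` … [possibly replacing `G` by some finite étale covering of `G`] there exists a finite étale …
`Π_G`-covering `G' → G` whose restriction to the anabelioid `G_{e₂}` is trivial, but whose restriction to
the anabelioid `G_{e₁}` is nontrivial" [cite: MochizukiCombGC2007, Prop 1.2 proof p.9].  Typed LEVEL-WISE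
as `PSCDatum.EdgeLikeSeparatingCoverings` (abc-iut-w4-d081; abc-iut FACT-LIST row F-2827, the edge conjunct
of F-2829; universal closure refuted; instance forms at genuine carriers are the content).

PROOF-ONLY file (abc-iut-f-166 gen 5), SHAPE-INDEPENDENT: "replacing `G` by a finite étale covering" taken
literally.  Let `ι : Γ → Π` be a profinite pro-`Σ` completion, `Π₀ ⊴ Π` open with `ι⁻¹(Π₀) = Ker χ` for a
character `χ : Γ → ℤ/n` with `χ(t) = 1`, and suppose every edge group is `Π_e = cl ι⟨x_e⟩` with `x_e` a
MEMBER OF SOME FREE BASIS OF THE LEVEL `Ker χ` (not necessarily of `Γ` — e.g. the node loop of an unmarked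
component, a product of commutators), together with CERTIFICATES: for `(e₁, m) ≠ (e₂, 0)`, `m < n`, a
homomorphism `Ker χ → ℤ` killing `x_{e₂}` but not `t^m x_{e₁} t^{-m}`.  Then
`G.EdgeLikeSeparatingCoverings` holds with the separating level `V' := V ∩ Π₀`
(`edgeLikeSeparatingCoverings_of_levelCertificates`): an ambient conjugation normalises `γ₂ ∈ Π₀`
(`exists_separating_of_conj`), `γ₁ = y₁ ι(t)^m` (`exists_mem_mul_pow_of_level`), and inside `Π₀` the gen-3
engines run along `ι| : Ker χ → Π₀` (`ProSigmaLevelSeparating.lean`, here over a NAMED level: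
`level_same_of_eq`, `level_cross_of_eq` with the certificate `retract_apply_ne_one_of_hom` built in).
`edgeLikeSeparatingCoverings_of_levelCertificates'` is the same with certificates into ARBITRARY groups
(non-abelian corners).  Consumers: the two-component datum with `C₁` unmarked (`PSCSeparatingCoveringsTwoComponentUnmarkedEdges.lean`,
abc-iut-f-166) and the irreducible nodal data (abc-iut-w5-d174's level free factor).  0 definitions;
nothing here takes a side on [IUTchIII] Cor. 3.12.
-/

noncomputable section

namespace Literature.AnabelianGeometry.SemiGraphs

open scoped Pointwise
open Multiplicative
open SemiGraphOfAnabelioids (IsProSigmaCompletion)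
open SemiGraphOfAnabelioids.IsProSigmaCompletion (level_exists_open_separating_sameVertex
  level_exists_open_separating_crossVertex retract_apply_ne_one_of_hom)

/-! ### Reductions: ambient conjugation, and level engines over a named level `K` -/

section Reductions

variable {Γ : Type} [Group Γ] {P : Type} [Group P] [TopologicalSpace P] [IsTopologicalGroup P]
  [CompactSpace P] [TotallyDisconnectedSpace P] {ι : Γ →* P} {Sigma : Set ℕ}

omit [CompactSpace P] [TotallyDisconnectedSpace P] in
/-- **Ambient conjugation.**  A separating open subgroup for the translated pair `(g γ₁, g γ₂)` inside the
normal level `V` is carried back to one for `(γ₁, γ₂)` by conjugating with `g⁻¹`.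
[cite: MochizukiCombGC2007, Prop 1.2 proof p.9] -/
theorem exists_separating_of_conj (V : Subgroup P) [hVn : V.Normal] (A₁ A₂ : Subgroup P)
    (x₁ x₂ g : ConjAct P) (U' : Subgroup P) (hU'o : IsOpen (U' : Set P)) (hU'V : U' ≤ V)
    (hn : (U'.subgroupOf V).Normal) (h₂ : ((g * x₂) • A₂) ⊓ V ≤ U') (h₁ : ¬ (((g * x₁) • A₁) ⊓ V ≤ U')) :
    ∃ U : Subgroup P, IsOpen (U : Set P) ∧ U ≤ V ∧ (U.subgroupOf V).Normal ∧
      (x₂ • A₂) ⊓ V ≤ U ∧ ¬ ((x₁ • A₁) ⊓ V ≤ U) := by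
  have hVg : ∀ h : ConjAct P, h • V = V := fun h => hVn.conjAct h
  have key : ∀ (x : ConjAct P) (A : Subgroup P), g⁻¹ • (((g * x) • A) ⊓ V) = (x • A) ⊓ V := by
    intro x A
    rw [Subgroup.smul_inf, ← mul_smul, inv_mul_cancel_left, hVg]
  refine ⟨g⁻¹ • U', ?_, ?_, ?_, ?_, fun hle => h₁ ?_⟩
  · -- openness: a conjugate of an open subgroup
    have hset : ((g⁻¹ • U' : Subgroup P) : Set P) =
        (fun x : P => (ConjAct.ofConjAct g⁻¹)⁻¹ * x * ConjAct.ofConjAct g⁻¹) ⁻¹' (U' : Set P) := by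
      ext x
      rw [SetLike.mem_coe, Subgroup.mem_pointwise_smul_iff_inv_smul_mem, ConjAct.smul_def, map_inv,
        inv_inv, Set.mem_preimage, SetLike.mem_coe]
    rw [hset]
    exact hU'o.preimage ((continuous_const.mul continuous_id).mul continuous_const)
  · calc g⁻¹ • U' ≤ g⁻¹ • V := Subgroup.pointwise_smul_le_pointwise_smul_iff.mpr hU'V
      _ = V := hVg _
  · refine ⟨fun u hu v => ?_⟩
    rw [Subgroup.mem_subgroupOf] at hu ⊢
    rw [Subgroup.mem_pointwise_smul_iff_inv_smul_mem, inv_inv] at hu ⊢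
    have hv' : g • (v : P) ∈ V := by
      have h := Subgroup.smul_mem_pointwise_smul _ g _ v.2
      rwa [hVg g] at h
    have hu' : g • (u : P) ∈ V := by
      have h := Subgroup.smul_mem_pointwise_smul _ g _ u.2
      rwa [hVg g] at h
    have h := hn.conj_mem ⟨g • (u : P), hu'⟩ (by rw [Subgroup.mem_subgroupOf]; exact hu) ⟨g • (v : P), hv'⟩
    rw [Subgroup.mem_subgroupOf] at h
    simpa [smul_mul', ConjAct.smul_def, mul_assoc] using h
  · rw [← key x₂ A₂]
    exact Subgroup.pointwise_smul_le_pointwise_smul_iff.mpr h₂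
  · have h := (Subgroup.pointwise_smul_le_pointwise_smul_iff (a := g)).mpr hle
    rwa [← key x₁ A₁, ← mul_smul, ← mul_smul, mul_inv_cancel, one_smul, one_smul] at h

/-- **Level fibred twist over a named level** (`K = ι⁻¹(Π₀)` as a variable, so that a free basis of `K`
may be fed directly): `ProSigmaLevelSeparating.level_exists_open_separating_sameVertex`.
[cite: MochizukiCombGC2007, Prop 1.2 proof p.9] -/
theorem level_same_of_eq (hι : IsProSigmaCompletion Sigma ι) (P₀ : Subgroup P) [P₀.Normal]
    (hP₀ : IsOpen (P₀ : Set P)) (K : Subgroup Γ) (hK : P₀.comap ι = K) {β : Type*}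
    (bL : FreeGroupBasis β K) (s : β) {ℓ : ℕ} (hℓ : ℓ.Prime) (hℓS : ℓ ∈ Sigma) (A : Subgroup P)
    (hA : A = ((Subgroup.zpowers ((bL s : K) : Γ)).map ι).topologicalClosure)
    (V : Subgroup P) [V.Normal] (hVo : IsOpen (V : Set P)) (hVP : V ≤ P₀) {y₁ y₂ : P} (hy₁ : y₁ ∈ P₀)
    (hy₂ : y₂ ∈ P₀)
    (hne : DoubleCoset.doubleCoset y₁ (V : Set P) (A : Set P) ≠ DoubleCoset.doubleCoset y₂ (V : Set P) (A : Set P)) :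
    ∃ U : Subgroup P, IsOpen (U : Set P) ∧ U ≤ V ∧ (U.subgroupOf V).Normal ∧
      (ConjAct.toConjAct y₂ • A) ⊓ V ≤ U ∧ ¬ ((ConjAct.toConjAct y₁ • A) ⊓ V ≤ U) := by
  subst hK
  refine level_exists_open_separating_sameVertex hι P₀ hP₀ bL {s} ⟨s, rfl⟩ hℓ hℓS A ?_ V hVo hVP hy₁ hy₂ hne
  rw [hA, Set.image_singleton, ← Subgroup.zpowers_eq_closure]
  simp only [MonoidHom.map_zpowers, Subgroup.coe_subtype]

/-- **Level projection over a named level**, with the certificate built in: a homomorphism `ψ` of the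
level killing the letter `bL s` but not `z` (`ProSigmaLevelSeparating.level_exists_open_separating_crossVertex`
+ `retract_apply_ne_one_of_hom`). [cite: MochizukiCombGC2007, Prop 1.2 proof p.9] -/
theorem level_cross_of_eq (hι : IsProSigmaCompletion Sigma ι) (hSig : ∃ ℓ ∈ Sigma, ℓ.Prime)
    (P₀ : Subgroup P) [P₀.Normal] (hP₀ : IsOpen (P₀ : Set P)) (K : Subgroup Γ) (hK : P₀.comap ι = K)
    {β : Type*} (bL : FreeGroupBasis β K) (s : β) (A₂ : Subgroup P)
    (hA₂ : A₂ = ((Subgroup.zpowers ((bL s : K) : Γ)).map ι).topologicalClosure)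
    (A₁ : Subgroup P) (z : K) (hzA : ι (z : Γ) ∈ A₁) {M : Type*} [Group M] (ψ : K →* M)
    (hψs : ψ (bL s) = 1) (hψz : ψ z ≠ 1)
    (V : Subgroup P) [V.Normal] (hVo : IsOpen (V : Set P)) (hVP : V ≤ P₀) {y₁ y₂ : P} (hy₁ : y₁ ∈ P₀)
    (hy₂ : y₂ ∈ P₀) :
    ∃ U : Subgroup P, IsOpen (U : Set P) ∧ U ≤ V ∧ (U.subgroupOf V).Normal ∧
      (ConjAct.toConjAct y₂ • A₂) ⊓ V ≤ U ∧ ¬ ((ConjAct.toConjAct y₁ • A₁) ⊓ V ≤ U) := by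
  classical
  subst hK
  let ρ : (P₀.comap ι) →* (P₀.comap ι) := bL.lift fun j => if j ∈ ({s} : Set β) then 1 else bL j
  have hρ : ∀ j, ρ (bL j) = if j ∈ ({s} : Set β) then 1 else bL j := fun j => by
    change FreeGroup.lift _ (bL.repr (bL j)) = _
    rw [FreeGroupBasis.repr_apply_coe, FreeGroup.lift_apply_of]
  have hρz : ρ z ≠ 1 :=
    retract_apply_ne_one_of_hom bL {s} ρ hρ ψ (fun j hj => by rw [Set.mem_singleton_iff.mp hj, hψs]) hψz
  refine level_exists_open_separating_crossVertex hι hSig P₀ hP₀ bL {s} ρ hρ A₂ ?_ A₁ z hzA hρz V hVo hVP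
    hy₁ hy₂
  rw [hA₂, Set.image_singleton, ← Subgroup.zpowers_eq_closure]
  simp only [MonoidHom.map_zpowers, Subgroup.coe_subtype]

omit [CompactSpace P] [TotallyDisconnectedSpace P] in
/-- **Coset decomposition along a level character.**  If `P₀ ⊴ Π` is open with `ι⁻¹(Π₀) = Ker χ`,
`χ : Γ → ℤ/n` with `χ(t) = 1`, then every `x ∈ Π` is `y · ι(t)^m` with `y ∈ Π₀`, `m < n`.
[cite: MochizukiCombGC2007, Prop 1.2 proof p.9] -/
theorem exists_mem_mul_pow_of_level (hι : IsProSigmaCompletion Sigma ι) (P₀ : Subgroup P) [P₀.Normal]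
    (hP₀ : IsOpen (P₀ : Set P)) {n : ℕ} [NeZero n] (χ : Γ →* Multiplicative (ZMod n))
    (hK : P₀.comap ι = χ.ker) (t : Γ) (ht : χ t = ofAdd 1) (x : P) :
    ∃ (m : ℕ) (y : P), m < n ∧ y ∈ P₀ ∧ x = y * ι t ^ m := by
  obtain ⟨δ, hδ⟩ := SemiGraphOfAnabelioids.IsProSigmaCompletion.exists_mem_coset hι P₀ hP₀ x
  set m : ℕ := (toAdd (χ δ)).val with hm
  have hκ : δ * (t ^ m)⁻¹ ∈ χ.ker := by
    rw [MonoidHom.mem_ker, map_mul, map_inv, map_pow, ht, ← ofAdd_nsmul, nsmul_eq_mul, mul_one, hm,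
      ZMod.natCast_zmod_val, ofAdd_toAdd, mul_inv_cancel]
  have hκP : ι (δ * (t ^ m)⁻¹) ∈ P₀ := by
    have : δ * (t ^ m)⁻¹ ∈ P₀.comap ι := by rw [hK]; exact hκ
    exact this
  refine ⟨m, x * (ι t ^ m)⁻¹, ZMod.val_lt _, ?_, by rw [inv_mul_cancel_right]⟩
  -- `x (ι t)^{-m} = (ι δ · p⁻¹) ι(t)^{-m}` with `p = x⁻¹ ι δ ∈ P₀`
  have e : x * (ι t ^ m)⁻¹ = ι (δ * (t ^ m)⁻¹) * (ι t ^ m * (x⁻¹ * ι δ)⁻¹ * (ι t ^ m)⁻¹) := by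
    rw [map_mul, map_inv, map_pow]; group
  rw [e]
  exact P₀.mul_mem hκP (‹P₀.Normal›.conj_mem _ (P₀.inv_mem hδ) _)

end Reductions

/-! ### The shape-independent assembly: edge groups generated by members of level bases -/

namespace PSCDatum

section Assembly

variable {Γ : Type} [Group Γ] {P : Type} [Group P] [TopologicalSpace P] [IsTopologicalGroup P]
  [CompactSpace P] [TotallyDisconnectedSpace P] {ι : Γ →* P} {Sigma : Set ℕ}

omit [CompactSpace P] [TotallyDisconnectedSpace P] in
/-- Conjugating the closed cyclic subgroup `cl ι⟨x⟩` by `ι(u)` gives `cl ι⟨u x u⁻¹⟩`.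
[cite: MochizukiCombGC2007, Prop 1.2 proof p.9] -/
theorem toConjAct_smul_topologicalClosure_map_zpowers (u x : Γ) :
    ConjAct.toConjAct (ι u) • ((Subgroup.zpowers x).map ι).topologicalClosure =
      ((Subgroup.zpowers (u * x * u⁻¹)).map ι).topologicalClosure := by
  rw [← topologicalClosure_conjAct_smul, MonoidHom.map_zpowers, MonoidHom.map_zpowers,
    Subgroup.pointwise_smul_def, MonoidHom.map_zpowers]
  congr 2
  simp [ConjAct.toConjAct_smul, map_mul, map_inv]

omit [TopologicalSpace P] [IsTopologicalGroup P] [CompactSpace P] [TotallyDisconnectedSpace P] in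
/-- Double cosets of a normal `V` are translated by left multiplication:
`V (c y) A = c · (V y A)`. [cite: MochizukiCombGC2007, Prop 1.2 proof p.9] -/
theorem doubleCoset_mul_left_eq_image (V : Subgroup P) [hV : V.Normal] (A : Set P) (c y : P) :
    DoubleCoset.doubleCoset (c * y) (V : Set P) A = (fun z => c * z) '' DoubleCoset.doubleCoset y (V : Set P) A := by
  ext z
  simp only [DoubleCoset.mem_doubleCoset, Set.mem_image, SetLike.mem_coe]
  constructor
  · rintro ⟨v, hv, a, ha, rfl⟩
    refine ⟨c⁻¹ * v * c * y * a, ⟨c⁻¹ * v * c, ?_, a, ha, by group⟩, by group⟩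
    simpa using hV.conj_mem v hv c⁻¹
  · rintro ⟨_, ⟨v, hv, a, ha, rfl⟩, rfl⟩
    refine ⟨c * v * c⁻¹, hV.conj_mem v hv c, a, ha, by group⟩

/-- **[CombGC] Prop. 1.2, proof p. 9 — edge-like separating coverings from LEVEL certificates**
(shape-independent).  Let `ι : Γ → Π` be a profinite pro-`Σ` completion, `ℓ ∈ Σ`, `Π₀ ⊴ Π` open with
`ι⁻¹(Π₀) = Ker χ` for a character `χ : Γ → ℤ/n` with `χ(t) = 1`.  Suppose every edge group of `G` is
`Π_e = cl ι⟨x_e⟩` with `x_e ∈ Ker χ` a MEMBER OF SOME FREE BASIS of the level `Ker χ`, and that for all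
`e₁, e₂`, `m < n` with `(e₁, m) ≠ (e₂, 0)` some homomorphism `Ker χ → ℤ` kills `x_{e₂}` but not
`t^m x_{e₁} t^{-m}` (a certificate).  Then `G.EdgeLikeSeparatingCoverings` holds, with `V' := V ∩ Π₀`:
normalise `γ₂ ∈ Π₀` by an ambient conjugation, write `γ₁ = y₁ ι(t)^m`, and separate inside `Π₀` by the
level fibred twist (same edge, `m = 0`) or the certified level projection (otherwise).
[cite: MochizukiCombGC2007, Prop 1.2 proof p.9] -/
theorem edgeLikeSeparatingCoverings_of_levelCertificates (hι : IsProSigmaCompletion Sigma ι) {ℓ : ℕ}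
    (hℓ : ℓ.Prime) (hℓS : ℓ ∈ Sigma) (G : PSCDatum P) (P₀ : Subgroup P) [P₀.Normal]
    (hP₀ : IsOpen (P₀ : Set P)) {n : ℕ} [NeZero n] (χ : Γ →* Multiplicative (ZMod n))
    (hK : P₀.comap ι = χ.ker) (t : Γ) (ht : χ t = ofAdd 1) (x : G.graph.N ⊕ G.graph.C → Γ)
    (hx : ∀ e, x e ∈ χ.ker)
    (hedge : ∀ e, G.edgeGp e = ((Subgroup.zpowers (x e)).map ι).topologicalClosure)
    (hbasis : ∀ e, ∃ (β : Type) (bL : FreeGroupBasis β χ.ker) (s : β), ((bL s : χ.ker) : Γ) = x e)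
    (hcert : ∀ (e₁ e₂ : G.graph.N ⊕ G.graph.C) (m : ℕ), m < n → (e₁ ≠ e₂ ∨ m ≠ 0) →
      ∃ ψ : χ.ker →* Multiplicative ℤ, ψ ⟨x e₂, hx e₂⟩ = 1 ∧
        ψ ⟨t ^ m * x e₁ * (t ^ m)⁻¹, (MonoidHom.normal_ker χ).conj_mem _ (hx e₁) _⟩ ≠ 1) :
    G.EdgeLikeSeparatingCoverings := by
  classical
  intro V hVn hVo
  haveI : (V ⊓ P₀).Normal := inferInstance
  refine ⟨V ⊓ P₀, inferInstance, hVo.inter hP₀, inf_le_left, ?_⟩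
  intro e₁ e₂ γ₁ γ₂ hne
  have hV'P : V ⊓ P₀ ≤ P₀ := inf_le_right
  have hV'o : IsOpen ((V ⊓ P₀ : Subgroup P) : Set P) := hVo.inter hP₀
  -- normalise the second conjugator into `Π₀`
  obtain ⟨m₂, y₂, -, hy₂, h₂⟩ := exists_mem_mul_pow_of_level hι P₀ hP₀ χ hK t ht (ConjAct.ofConjAct γ₂)
  set c : P := (ι t ^ m₂)⁻¹ with hc
  have hy₂' : c * ConjAct.ofConjAct γ₂ ∈ P₀ := by
    rw [h₂, hc, ← mul_assoc]
    simpa [mul_assoc] using (‹P₀.Normal›.conj_mem y₂ hy₂ (ι t ^ m₂)⁻¹)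
  -- decompose the translated first conjugator
  obtain ⟨m, y₁, hm, hy₁, h₁⟩ := exists_mem_mul_pow_of_level hι P₀ hP₀ χ hK t ht (c * ConjAct.ofConjAct γ₁)
  -- it suffices to separate the translated pair
  suffices H : ∃ U : Subgroup P, IsOpen (U : Set P) ∧ U ≤ V ⊓ P₀ ∧ (U.subgroupOf (V ⊓ P₀)).Normal ∧
      (ConjAct.toConjAct (c * ConjAct.ofConjAct γ₂) • G.edgeGp e₂) ⊓ (V ⊓ P₀) ≤ U ∧
      ¬ ((ConjAct.toConjAct (c * ConjAct.ofConjAct γ₁) • G.edgeGp e₁) ⊓ (V ⊓ P₀) ≤ U) by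
    obtain ⟨U', hU'o, hU'V, hU'n, h2, h1⟩ := H
    rw [map_mul, ConjAct.toConjAct_ofConjAct] at h2 h1
    exact exists_separating_of_conj (V ⊓ P₀) (G.edgeGp e₁) (G.edgeGp e₂) γ₁ γ₂ (ConjAct.toConjAct c) U'
      hU'o hU'V hU'n h2 h1
  -- the translated first conjugate is `y₁ • cl ι⟨t^m x_{e₁} t^{-m}⟩`
  have hA₁ : ConjAct.toConjAct (c * ConjAct.ofConjAct γ₁) • G.edgeGp e₁ =
      ConjAct.toConjAct y₁ • ((Subgroup.zpowers (t ^ m * x e₁ * (t ^ m)⁻¹)).map ι).topologicalClosure := by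
    rw [h₁, map_mul, mul_smul, hedge, ← map_pow, toConjAct_smul_topologicalClosure_map_zpowers]
  rw [hA₁]
  by_cases hsame : e₁ = e₂ ∧ m = 0
  · -- same edge, same coset of `Π₀`: the level fibred twist
    obtain ⟨rfl, rfl⟩ := hsame
    obtain ⟨β, bL, s, hs⟩ := hbasis e₁
    have hA : G.edgeGp e₁ = ((Subgroup.zpowers ((bL s : χ.ker) : Γ)).map ι).topologicalClosure := by
      rw [hedge, hs]
    have e0 : ((Subgroup.zpowers (t ^ 0 * x e₁ * (t ^ 0)⁻¹)).map ι).topologicalClosure = G.edgeGp e₁ := by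
      rw [hedge, pow_zero, one_mul, inv_one, mul_one]
    rw [e0]
    -- the double cosets of the translated pair differ
    have hdc : DoubleCoset.doubleCoset y₁ ((V ⊓ P₀ : Subgroup P) : Set P) (G.edgeGp e₁ : Set P) ≠
        DoubleCoset.doubleCoset (c * ConjAct.ofConjAct γ₂) ((V ⊓ P₀ : Subgroup P) : Set P)
          (G.edgeGp e₁ : Set P) := by
      have hy₁c : y₁ = c * ConjAct.ofConjAct γ₁ := by rw [h₁, pow_zero, mul_one]
      intro hEq
      rcases hne with hne | hne
      · exact hne rfl
      · apply hne
        have h' := congrArg (Set.image fun z => c⁻¹ * z) hEq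
        rw [hy₁c, doubleCoset_mul_left_eq_image, doubleCoset_mul_left_eq_image, Set.image_image,
          Set.image_image] at h'
        simpa using h'
    exact level_same_of_eq hι P₀ hP₀ χ.ker hK bL s hℓ hℓS (G.edgeGp e₁) hA (V ⊓ P₀) hV'o hV'P hy₁ hy₂' hdc
  · -- different level edges: the certified level projection
    have hcase : e₁ ≠ e₂ ∨ m ≠ 0 := by
      by_cases h : e₁ = e₂
      · exact Or.inr fun hm0 => hsame ⟨h, hm0⟩
      · exact Or.inl h
    obtain ⟨ψ, hψ₂, hψ₁⟩ := hcert e₁ e₂ m hm hcase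
    obtain ⟨β, bL, s, hs⟩ := hbasis e₂
    have hA₂ : G.edgeGp e₂ = ((Subgroup.zpowers ((bL s : χ.ker) : Γ)).map ι).topologicalClosure := by
      rw [hedge, hs]
    have hψs : ψ (bL s) = 1 := by
      rw [show bL s = ⟨x e₂, hx e₂⟩ from Subtype.ext hs]; exact hψ₂
    have hzA : ι ((⟨t ^ m * x e₁ * (t ^ m)⁻¹, (MonoidHom.normal_ker χ).conj_mem _ (hx e₁) _⟩ : χ.ker) : Γ) ∈
        ((Subgroup.zpowers (t ^ m * x e₁ * (t ^ m)⁻¹)).map ι).topologicalClosure :=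
      Subgroup.le_topologicalClosure _ (Subgroup.mem_map_of_mem ι (Subgroup.mem_zpowers _))
    exact level_cross_of_eq hι ⟨ℓ, hℓS, hℓ⟩ P₀ hP₀ χ.ker hK bL s (G.edgeGp e₂) hA₂ _ _ hzA ψ hψs hψ₁ (V ⊓ P₀)
      hV'o hV'P hy₁ hy₂'

/-- **The same assembly with certificates valued in ARBITRARY groups** (for the non-abelian corners: a
cuspless node whose loop is a product of commutators even in the level, [CombGC] Prop. 1.2 proof p. 9):
for `(e₁, m) ≠ (e₂, 0)` a homomorphism of the level into SOME group killing `x_{e₂}` but not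
`t^m x_{e₁} t^{-m}`. [cite: MochizukiCombGC2007, Prop 1.2 proof p.9] -/
theorem edgeLikeSeparatingCoverings_of_levelCertificates' (hι : IsProSigmaCompletion Sigma ι) {ℓ : ℕ}
    (hℓ : ℓ.Prime) (hℓS : ℓ ∈ Sigma) (G : PSCDatum P) (P₀ : Subgroup P) [P₀.Normal]
    (hP₀ : IsOpen (P₀ : Set P)) {n : ℕ} [NeZero n] (χ : Γ →* Multiplicative (ZMod n))
    (hK : P₀.comap ι = χ.ker) (t : Γ) (ht : χ t = ofAdd 1) (x : G.graph.N ⊕ G.graph.C → Γ)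
    (hx : ∀ e, x e ∈ χ.ker)
    (hedge : ∀ e, G.edgeGp e = ((Subgroup.zpowers (x e)).map ι).topologicalClosure)
    (hbasis : ∀ e, ∃ (β : Type) (bL : FreeGroupBasis β χ.ker) (s : β), ((bL s : χ.ker) : Γ) = x e)
    (hcert : ∀ (e₁ e₂ : G.graph.N ⊕ G.graph.C) (m : ℕ), m < n → (e₁ ≠ e₂ ∨ m ≠ 0) →
      ∃ (M : Type) (_ : Group M) (ψ : χ.ker →* M), ψ ⟨x e₂, hx e₂⟩ = 1 ∧
        ψ ⟨t ^ m * x e₁ * (t ^ m)⁻¹, (MonoidHom.normal_ker χ).conj_mem _ (hx e₁) _⟩ ≠ 1) :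
    G.EdgeLikeSeparatingCoverings := by
  classical
  intro V hVn hVo
  haveI : (V ⊓ P₀).Normal := inferInstance
  refine ⟨V ⊓ P₀, inferInstance, hVo.inter hP₀, inf_le_left, ?_⟩
  intro e₁ e₂ γ₁ γ₂ hne
  have hV'P : V ⊓ P₀ ≤ P₀ := inf_le_right
  have hV'o : IsOpen ((V ⊓ P₀ : Subgroup P) : Set P) := hVo.inter hP₀
  obtain ⟨m₂, y₂, -, hy₂, h₂⟩ := exists_mem_mul_pow_of_level hι P₀ hP₀ χ hK t ht (ConjAct.ofConjAct γ₂)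
  set c : P := (ι t ^ m₂)⁻¹ with hc
  have hy₂' : c * ConjAct.ofConjAct γ₂ ∈ P₀ := by
    rw [h₂, hc, ← mul_assoc]
    simpa [mul_assoc] using (‹P₀.Normal›.conj_mem y₂ hy₂ (ι t ^ m₂)⁻¹)
  obtain ⟨m, y₁, hm, hy₁, h₁⟩ := exists_mem_mul_pow_of_level hι P₀ hP₀ χ hK t ht (c * ConjAct.ofConjAct γ₁)
  suffices H : ∃ U : Subgroup P, IsOpen (U : Set P) ∧ U ≤ V ⊓ P₀ ∧ (U.subgroupOf (V ⊓ P₀)).Normal ∧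
      (ConjAct.toConjAct (c * ConjAct.ofConjAct γ₂) • G.edgeGp e₂) ⊓ (V ⊓ P₀) ≤ U ∧
      ¬ ((ConjAct.toConjAct (c * ConjAct.ofConjAct γ₁) • G.edgeGp e₁) ⊓ (V ⊓ P₀) ≤ U) by
    obtain ⟨U', hU'o, hU'V, hU'n, h2, h1⟩ := H
    rw [map_mul, ConjAct.toConjAct_ofConjAct] at h2 h1
    exact exists_separating_of_conj (V ⊓ P₀) (G.edgeGp e₁) (G.edgeGp e₂) γ₁ γ₂ (ConjAct.toConjAct c) U'
      hU'o hU'V hU'n h2 h1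
  have hA₁ : ConjAct.toConjAct (c * ConjAct.ofConjAct γ₁) • G.edgeGp e₁ =
      ConjAct.toConjAct y₁ • ((Subgroup.zpowers (t ^ m * x e₁ * (t ^ m)⁻¹)).map ι).topologicalClosure := by
    rw [h₁, map_mul, mul_smul, hedge, ← map_pow, toConjAct_smul_topologicalClosure_map_zpowers]
  rw [hA₁]
  by_cases hsame : e₁ = e₂ ∧ m = 0
  · obtain ⟨rfl, rfl⟩ := hsame
    obtain ⟨β, bL, s, hs⟩ := hbasis e₁
    have hA : G.edgeGp e₁ = ((Subgroup.zpowers ((bL s : χ.ker) : Γ)).map ι).topologicalClosure := by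
      rw [hedge, hs]
    have e0 : ((Subgroup.zpowers (t ^ 0 * x e₁ * (t ^ 0)⁻¹)).map ι).topologicalClosure = G.edgeGp e₁ := by
      rw [hedge, pow_zero, one_mul, inv_one, mul_one]
    rw [e0]
    have hdc : DoubleCoset.doubleCoset y₁ ((V ⊓ P₀ : Subgroup P) : Set P) (G.edgeGp e₁ : Set P) ≠
        DoubleCoset.doubleCoset (c * ConjAct.ofConjAct γ₂) ((V ⊓ P₀ : Subgroup P) : Set P)
          (G.edgeGp e₁ : Set P) := by
      have hy₁c : y₁ = c * ConjAct.ofConjAct γ₁ := by rw [h₁, pow_zero, mul_one]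
      intro hEq
      rcases hne with hne | hne
      · exact hne rfl
      · apply hne
        have h' := congrArg (Set.image fun z => c⁻¹ * z) hEq
        rw [hy₁c, doubleCoset_mul_left_eq_image, doubleCoset_mul_left_eq_image, Set.image_image,
          Set.image_image] at h'
        simpa using h'
    exact level_same_of_eq hι P₀ hP₀ χ.ker hK bL s hℓ hℓS (G.edgeGp e₁) hA (V ⊓ P₀) hV'o hV'P hy₁ hy₂' hdc
  · have hcase : e₁ ≠ e₂ ∨ m ≠ 0 := by
      by_cases h : e₁ = e₂
      · exact Or.inr fun hm0 => hsame ⟨h, hm0⟩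
      · exact Or.inl h
    obtain ⟨M, _, ψ, hψ₂, hψ₁⟩ := hcert e₁ e₂ m hm hcase
    obtain ⟨β, bL, s, hs⟩ := hbasis e₂
    have hA₂ : G.edgeGp e₂ = ((Subgroup.zpowers ((bL s : χ.ker) : Γ)).map ι).topologicalClosure := by
      rw [hedge, hs]
    have hψs : ψ (bL s) = 1 := by
      rw [show bL s = ⟨x e₂, hx e₂⟩ from Subtype.ext hs]; exact hψ₂
    have hzA : ι ((⟨t ^ m * x e₁ * (t ^ m)⁻¹, (MonoidHom.normal_ker χ).conj_mem _ (hx e₁) _⟩ : χ.ker) : Γ) ∈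
        ((Subgroup.zpowers (t ^ m * x e₁ * (t ^ m)⁻¹)).map ι).topologicalClosure :=
      Subgroup.le_topologicalClosure _ (Subgroup.mem_map_of_mem ι (Subgroup.mem_zpowers _))
    exact level_cross_of_eq hι ⟨ℓ, hℓS, hℓ⟩ P₀ hP₀ χ.ker hK bL s (G.edgeGp e₂) hA₂ _ _ hzA ψ hψs hψ₁ (V ⊓ P₀)
      hV'o hV'P hy₁ hy₂'

end Assembly

end PSCDatum

end Literature.AnabelianGeometry.SemiGraphs

end
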